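/-
Copyright (c) 2026 the pub-hodgecm-mathlib formalisation cell (harness21).  Prover seat hodgecm-mathlib-F0P3-p01 (g18), 2026-09-01.  ED. 38 «PK-ε» (RULING D53-pre, LEAD T11-64∕66∕69):
★4 — the W-twins of the three `GTraceProductForm`-producing theorems, for the ξ-dependent sign `w_ξ = ε(½, φ_ξ)` of Rogawski's erratum [Rogawski1992 Thm. 1.2].
-/
import Summits.HodgeConjecture.HodgeConjecture.Theorems.F0P3SpectralPacketXiSignedProductForm     -- ★ (N) 3q′: `gTraceProductForm_ghOfFibres_of_xiPacketsSigned` (+ ★ 3q `XiPacketsSigned`, `piXiS`, `trSψ_piXiS_eq`)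
import Summits.HodgeConjecture.HodgeConjecture.Theorems.F0P3SpectralPacketHomogeneousLetters       -- ★ (N) 3w′: `gTraceProductForm_ghOfFibres_hom` (+ `HomogPacketG`, `XiPacketsSignedHom`, `piXiHm`)
import Summits.HodgeConjecture.HodgeConjecture.Theorems.F0P3SpectralPacketCoherentLetters          -- ★ (N) 3v′: `gTraceProductForm_ghOfFibres_coh` (+ `CohPacketG`, `XiPacketsSignedCoh`, `piXiC`)
import Summits.HodgeConjecture.HodgeConjecture.Theorems.F0P3bLocalExpansionAtKitOfRecordW      -- ★2 (P3b, F0P3b-p01 (g13)): `GTraceProductFormW` (+ ★1 `F0P3KitOfRecordW`)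
import HarnessLib

/-!
# ED. 38 «PK-ε», ★4 — (P3′)-G OF LETTER K9-STF WITH THE ξ-DEPENDENT SIGN: `GTraceProductFormW` AT `ghOfFibres …` FROM THE SIGNED ξ-PACKET SHAPES
# (Rogawski §13.2 p. 200; §14.6 p. 244 ll. 6–17; erratum Rogawski (1992) Thm. 1.2)

Cell `hodgecm-mathlib`, F0∕P3 «U3-mult», crux H413 (`stmt-HodgeConjecture-24833`), route of record `HCCMUnconditional`.  ED. 38 «PK-ε» (ref1-OBJ-3; LEAD T11-64∕T11-66∕T11-69;
desk RULING D53-pre `F0/P3/F0P3-plan/g12/ed38/RULING-D53pre.ED38-PKeps.F0P3plan-g12.md` PART A ★4), pen F0P3-p01 (g18).  PROOF LANE: three theorems, 0 definitions, no instance,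
no notation, no named fact, no `sorry`; `--supports stmt-HodgeConjecture-24833`.  HONEST LABEL: HC_CM is proved only modulo the printed citations until rung 0 closes; this
file proves no printed statement — it re-derives clause (P3′)-G of letter K9-STF in its W-form (`GTraceProductFormW`, ★2 `F0P3bLocalExpansionAtKitOfRecordW`, F0P3b desk) at
the three (N) tuples (spectral ∕ homogeneous-coherent ∕ coherent `PG`), BY NAME, from the SAME signed ξ-packet shapes ★ `XiPacketsSigned` ∕ `XiPacketsSignedHom` ∕
`XiPacketsSignedCoh` (which already carry an arbitrary `κ : OneDimAutRepH L → ℤ`), with the ONE change the erratum demands: the signed shape's scalar is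
`κ ξ = [cptXi₀ ι μω ξ] · (−1)^N · w_ξ` with `w : OneDimAutRepH L → ℤ` the ξ-dependent sign (`w_ξ = ε(½, φ_ξ)`, global root number of `φ_ξ = μ·χ_{1,E}`; [Rogawski1992
Thm. 1.2], [GerbelliGauthier2019 Thm. 22–24, Rem. 23]) — the sign sits on the SIGNED `G`-term only (LEAD T11-66, P3b (P6)); the H-side clause `HTraceProductForm` is unchanged.
The three proofs are the ★ proofs token for token (`MatchesS ↔ fSG = fS`, then ★ `trSψ_piXiS_eq` ∕ `IsSignedPacketOf.trSψ_eq_mul_finsum`, then `hκ`).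

* `gTraceProductFormW_ghOfFibres_of_xiPacketsSigned` — twin of ★ 3q′ `gTraceProductForm_ghOfFibres_of_xiPacketsSigned` (`PG := SpectralPacketG 𝔩 𝔞 μ`);
* `gTraceProductFormW_ghOfFibres_hom` — twin of ★ 3w′ (w5) `gTraceProductForm_ghOfFibres_hom` (`PG := HomogPacketG …`; the variant T-B `k9stfS_of_tuple` consumes);
* `gTraceProductFormW_ghOfFibres_coh` — twin of ★ 3v′ (v5) `gTraceProductForm_ghOfFibres_coh` (`PG := CohPacketG …`).

References: [Rogawski1990] §13.2 p. 200 l. 1–3; §13.1 Prop. 13.1.3 (b)(d) p. 199; §12.3 Prop. 12.3.3 p. 178; §14.4 Prop. 14.4.1 (a) p. 235; §14.6 p. 243, p. 244 ll. 6–17;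
[Rogawski1992] Thm. 1.2 (the multiplicity formula with `ε(½, φ)`); [GerbelliGauthier2019] Thm. 22, Rem. 23, Thm. 24.
-/

set_option autoImplicit false
-- the mandated namespace repeats `HodgeConjecture.HodgeConjecture`, as in every `Theorems/*.lean` of this sub-problem
set_option linter.dupNamespace false

noncomputable section

open NumberField IsDedekindDomain MeasureTheory
open scoped Matrix MatrixGroups

open Literature.NumberTheory Literature.NumberTheory.Automorphic Literature.NumberTheory.Automorphic.UnitaryGroup
open Literature.NumberTheory.Rogawski1990 Literature.NumberTheory.GaloisRepresentations
open Literature.RepresentationTheory.BorelWallach2000 Literature.RepresentationTheory.KonnoKonno2007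
open Summit.HodgeConjecture.HodgeConjecture.Cruxes.H413.F0P3InnerFormClassificationV6 (Gp Places Cinf Sockets TestGp TestG TestH splitForm)
open Summit.HodgeConjecture.HodgeConjecture.Cruxes.H413.F0P3InnerFormClassificationV6.ClassificationKit (memberCoeff)
open Summit.HodgeConjecture.HodgeConjecture.Cruxes.H413.F0P3LocalPacketKit
open Summit.HodgeConjecture.HodgeConjecture.Cruxes.H413.F0P3ArchPacketKit
open Summit.HodgeConjecture.HodgeConjecture.Cruxes.H413.F0P3SemilocalTestFunctionsOfRecord (TestS₀ tens₀)
open Summit.HodgeConjecture.HodgeConjecture.Cruxes.H413.F0P3TestFunctionsOfRecord (Unr₀)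
open Summit.HodgeConjecture.HodgeConjecture.Cruxes.H413.F0P3KitOfRecord (GHSide XiSide cptXi₀)
open Summit.HodgeConjecture.HodgeConjecture.Cruxes.H413.F0P3XiArchDataOfRecord (nCompactOfRecord)
open Summit.HodgeConjecture.HodgeConjecture.Cruxes.H413.F0P3XiArchPacketOfRecord (archPacketOfRecord)
open Summit.HodgeConjecture.HodgeConjecture.Cruxes.H413.F0P3GHSideOfFibres (ghOfFibres)


open Summit.HodgeConjecture.HodgeConjecture.Cruxes.H413.F0P3bLocalExpansionAtKitOfRecordW (GTraceProductFormW)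

namespace Summit.HodgeConjecture.HodgeConjecture.Cruxes.H413.F0P3SpectralPacket.SpectralPacketG

open Summit.HodgeConjecture.HodgeConjecture.Cruxes.H413.F0P3GlobalPacket

/-! ## §1 At the spectral tuple `PG := SpectralPacketG 𝔩 𝔞 μ` (twin of ★ 3q′) -/

section S

variable {L : Type} [Field L] [NumberField L] [IsCMField L] {H : Matrix (Fin 3) (Fin 3) L} {ι : L →+* ℂ} {T : GL (Fin 3) ℂ}
  {hT : (T : Matrix (Fin 3) (Fin 3) ℂ)ᴴ * H.map ι * (T : Matrix (Fin 3) (Fin 3) ℂ) = Literature.Geometry.ComplexHyperbolic.BallModel.J}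
  {𝔩 : ∀ v : HeightOneSpectrum (𝓞 ↥(maximalRealSubfield L)), LocalPacketKit L (splitForm L 3) v} {𝔞 : ArchPacketKit}
  {μ : Measure (adelicGroupData (↥(maximalRealSubfield L)) L (IsCMField.complexConj L) 3 (splitForm L 3)).automorphicQuotient}
  [SMulInvariantMeasure (adelicGroupData (↥(maximalRealSubfield L)) L (IsCMField.complexConj L) 3 (splitForm L 3)).Adelic
    (adelicGroupData (↥(maximalRealSubfield L)) L (IsCMField.complexConj L) 3 (splitForm L 3)).automorphicQuotient μ]
  [∀ v : HeightOneSpectrum (𝓞 ↥(maximalRealSubfield L)), MeasurableSpace ((cmDatum L 3 (splitForm L 3)).Local v)]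
  [∀ v : HeightOneSpectrum (𝓞 ↥(maximalRealSubfield L)), BorelSpace ((cmDatum L 3 (splitForm L 3)).Local v)]
  -- the `G′`-side sockets other than `PacketG` (the letter's `𝔰 := ⟨𝔨.traceGp, 𝔨.Smooth, PG, PH, nG, nH, trG, trH, 𝔨.Matches⟩`)
  {μGp : Measure (Gp L H).automorphicQuotient} [(Gp L H).IsAutomorphicMeasure μGp]
  {traceGp : TestGp L H →ₗ[ℂ] ℂ} {Smooth : TestGp L H → Prop} {PH : Type} {nG : SpectralPacketG 𝔩 𝔞 μ → ℂ} {nH : PH → ℂ}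
  {trG : SpectralPacketG 𝔩 𝔞 μ → TestG L → ℂ} {trH : PH → TestH L → ℂ} {Matches : TestGp L H → TestG L → TestH L → Prop}
  {Pk' : OneDimAutRepH L → ∀ v : HeightOneSpectrum (𝓞 ↥(maximalRealSubfield L)), CMLocalAPacket L H v} {κ : OneDimAutRepH L → ℤ}

open scoped Classical in
/-- **[ED. 38 «PK-ε» W-TWIN] (q7) (P3′)-G OF LETTER K9-STF AT THE TUPLE, BY NAME.**  For the letter's `gh := ghOfFibres ι T hT 𝔰 hg hsm trGS trHS` with the (N) slot `trGS S Q f′_S := Q.trSψ ψ S (ψ_* νG) archTr f′_S`,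
a ξ-side `ξd` reading `PiXi := piXiS hXiS` and `packFin := Pk′`, archimedean A-packets `archPacketOfRecord ι μω jInf dsInf`, and the ξ-DEPENDENT signed scalar `κ ξ = (−1)^N · [cptXi₀ ι μω ξ] · w_ξ` (`w_ξ = ε(½, φ_ξ) ∈ {±1}`, [Rogawski1992 Thm. 1.2]):
`GTraceProductFormW ι T hT gh ξd μω wXi jInf dsInf archTr νG` — «`Tr Π(ξ)_S(f_{S,G}) = [cptXi₀ ξ] · (−1)^N · (A πⁿ_ι − A πˢ_ι) · ∏_{v ∈ S} (Tr πⁿ_v − Tr πˢ_v)(f′_v)`» [13.1.3 (b); 12.3.3 (b); Prop. 14.4.1 (a);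
p. 244 ll. 6–17] — modulo ONE kit law (member admissibility of `Π(ξ)_v`, `hadm`).  Proof: `MatchesS ↔ fSG = fS` (★ `ghOfFibres`), then ★ FILE 3q `trSψ_piXiS_eq`.
[cite: Rogawski1990, §13.2 p. 200 l. 1–3; §13.1 Prop. 13.1.3 (b)(d) p. 199; §12.3 Prop. 12.3.3 p. 178; §14.4 Prop. 14.4.1 (a) p. 235; §14.6 p. 243, p. 244 ll. 6–17] -/
theorem gTraceProductFormW_ghOfFibres_of_xiPacketsSigned
    (ψ : ∀ v : HeightOneSpectrum (𝓞 ↥(maximalRealSubfield L)), (cmDatum L 3 H).Local v ≃ₜ* (cmDatum L 3 (splitForm L 3)).Local v)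
    (νG : ∀ v : HeightOneSpectrum (𝓞 ↥(maximalRealSubfield L)), @Measure ((cmDatum L 3 H).Local v) (borel _))
    (hνl : ∀ v : HeightOneSpectrum (𝓞 ↥(maximalRealSubfield L)), letI : MeasurableSpace ((cmDatum L 3 H).Local v) := borel _; (νG v).IsMulLeftInvariant)
    (hνc : ∀ v : HeightOneSpectrum (𝓞 ↥(maximalRealSubfield L)), letI : MeasurableSpace ((cmDatum L 3 H).Local v) := borel _; IsFiniteMeasureOnCompacts (νG v))
    (μω : HeckeCharacter L) (jInf dsInf : ℤ → ℤ → ℤ → GKIrrClass (uFormGroup (Fin 2) (Fin 1)))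
    (archTr : GKIrrClass (uFormGroup (Fin 2) (Fin 1)) → (UnitaryGroup.arch (↥(maximalRealSubfield L)) L (IsCMField.complexConj L) 3 H → ℂ) → ℂ)
    (hXiS : XiPacketsSigned 𝔩 𝔞 μ (transportAPackets ψ Pk') (archPacketOfRecord ι μω jInf dsInf) κ)
    (hadm : ∀ (ξ : OneDimAutRepH L) (v : HeightOneSpectrum (𝓞 ↥(maximalRealSubfield L))), ∀ π ∈ (𝔩 v).mem ((piXiS hXiS ξ).fin.loc v), π.IsAdmissible)
    (wXi : OneDimAutRepH L → ℤ)
    (hκ : ∀ ξ : OneDimAutRepH L, (κ ξ : ℂ) = (if cptXi₀ ι μω ξ then 1 else 0) * (-1) ^ nCompactOfRecord L * (wXi ξ : ℂ))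
    (hg : ∀ f' : TestGp L H, Smooth f' → ∃ (f : TestG L) (fH : TestH L), Matches f' f fH)
    (hsm : ∀ (S : Finset (Places L)) (fS : TestS₀ L H ι T hT S) (fT : Unr₀ L H S), Smooth (tens₀ S fS fT))
    (trHS : ∀ S : Finset (Places L), PH → TestS₀ L H ι T hT S → ℂ)
    (ξd : XiSide L H (SpectralPacketG 𝔩 𝔞 μ) PH) (hPi : ∀ ξ : OneDimAutRepH L, ξd.PiXi ξ = piXiS hXiS ξ)
    (hPk : ∀ (ξ : OneDimAutRepH L) (v : HeightOneSpectrum (𝓞 ↥(maximalRealSubfield L))), ξd.packFin ξ v = Pk' ξ v) :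
    GTraceProductFormW ι T hT
      (ghOfFibres ι T hT (⟨traceGp, Smooth, SpectralPacketG 𝔩 𝔞 μ, PH, nG, nH, trG, trH, Matches⟩ : Sockets L H μGp) hg hsm
        (fun S Q fS => Q.trSψ ψ S (fun v => @Measure.map _ _ (borel _) _ (ψ v) (νG v)) archTr fS) trHS)
      ξd μω wXi jInf dsInf archTr νG := by
  letI : ∀ v : HeightOneSpectrum (𝓞 ↥(maximalRealSubfield L)), MeasurableSpace ((cmDatum L 3 H).Local v) := fun _ => borel _
  haveI : ∀ v : HeightOneSpectrum (𝓞 ↥(maximalRealSubfield L)), BorelSpace ((cmDatum L 3 H).Local v) := fun _ => ⟨rfl⟩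
  haveI : ∀ v : HeightOneSpectrum (𝓞 ↥(maximalRealSubfield L)), (νG v).IsMulLeftInvariant := hνl
  haveI : ∀ v : HeightOneSpectrum (𝓞 ↥(maximalRealSubfield L)), IsFiniteMeasureOnCompacts (νG v) := hνc
  intro ξ S _ fS fSG fSH hm
  obtain ⟨hfS, -⟩ := hm
  rw [hfS]
  change (ξd.PiXi ξ).trSψ ψ S (fun v => @Measure.map _ _ (borel _) _ (ψ v) (νG v)) archTr fS = _
  rw [hPi ξ, trSψ_piXiS_eq ψ hXiS ξ (hadm ξ) S fS archTr, hκ ξ]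
  simp only [hPk ξ, mul_assoc]

end S

/-! ## §2 At the homogeneous coherent tuple `PG := HomogPacketG …` (twin of ★ 3w′ (w5)) -/

section H

variable {L : Type} [Field L] [NumberField L] [IsCMField L] {H : Matrix (Fin 3) (Fin 3) L} {ι : L →+* ℂ} {T : GL (Fin 3) ℂ}
  {hT : (T : Matrix (Fin 3) (Fin 3) ℂ)ᴴ * H.map ι * (T : Matrix (Fin 3) (Fin 3) ℂ) = Literature.Geometry.ComplexHyperbolic.BallModel.J}
  {𝔩 : ∀ v : HeightOneSpectrum (𝓞 ↥(maximalRealSubfield L)), LocalPacketKit L (splitForm L 3) v} {𝔞 : ArchPacketKit}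
  {μ : Measure (adelicGroupData (↥(maximalRealSubfield L)) L (IsCMField.complexConj L) 3 (splitForm L 3)).automorphicQuotient}
  [SMulInvariantMeasure (adelicGroupData (↥(maximalRealSubfield L)) L (IsCMField.complexConj L) 3 (splitForm L 3)).Adelic
    (adelicGroupData (↥(maximalRealSubfield L)) L (IsCMField.complexConj L) 3 (splitForm L 3)).automorphicQuotient μ]
  [∀ v : HeightOneSpectrum (𝓞 ↥(maximalRealSubfield L)), MeasurableSpace ((cmDatum L 3 (splitForm L 3)).Local v)]
  [∀ v : HeightOneSpectrum (𝓞 ↥(maximalRealSubfield L)), BorelSpace ((cmDatum L 3 (splitForm L 3)).Local v)]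
  -- the `G′`-side sockets other than `PacketG` (the letter's `𝔰 := ⟨𝔨.traceGp, 𝔨.Smooth, PG, PH, nG, nH, trG, trH, 𝔨.Matches⟩`)
  {μGp : Measure (Gp L H).automorphicQuotient} [(Gp L H).IsAutomorphicMeasure μGp]
  {infOf : GlobalPacket 𝔩 → 𝔞.PktInf} {aTok : ∀ v : HeightOneSpectrum (𝓞 ↥(maximalRealSubfield L)), Set (𝔩 v).Pkt}
  {traceGp : TestGp L H →ₗ[ℂ] ℂ} {Smooth : TestGp L H → Prop} {PH : Type} {nG : HomogPacketG 𝔩 𝔞 μ infOf aTok → ℂ} {nH : PH → ℂ}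
  {trG : HomogPacketG 𝔩 𝔞 μ infOf aTok → TestG L → ℂ} {trH : PH → TestH L → ℂ} {Matches : TestGp L H → TestG L → TestH L → Prop}
  {Pk' : OneDimAutRepH L → ∀ v : HeightOneSpectrum (𝓞 ↥(maximalRealSubfield L)), CMLocalAPacket L H v} {κ : OneDimAutRepH L → ℤ}

open scoped Classical in
/-- **[ED. 38 «PK-ε» W-TWIN] (w5) (P3′)-G OF LETTER K9-STF AT THE HOMOGENEOUS COHERENT TUPLE, BY NAME** (★ 3v′ re-cut at `PG := HomogPacketG …`, slots through `.1`).  For the letter's `gh := ghOfFibres ι T hT 𝔰 hg hsm trGS trHS` with the (N) slot `trGS S Q f′_S := Q.trSψ ψ S (ψ_* νG) archTr f′_S`,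
a ξ-side `ξd` reading `PiXi := piXiHm hXiS` and `packFin := Pk′`, archimedean A-packets `archPacketOfRecord ι μω jInf dsInf`, and the ξ-DEPENDENT signed scalar `κ ξ = (−1)^N · [cptXi₀ ι μω ξ] · w_ξ` (`w_ξ = ε(½, φ_ξ) ∈ {±1}`, [Rogawski1992 Thm. 1.2]):
`GTraceProductFormW ι T hT gh ξd μω wXi jInf dsInf archTr νG` — «`Tr Π(ξ)_S(f_{S,G}) = [cptXi₀ ξ] · (−1)^N · (A πⁿ_ι − A πˢ_ι) · ∏_{v ∈ S} (Tr πⁿ_v − Tr πˢ_v)(f′_v)`» [13.1.3 (b); 12.3.3 (b); Prop. 14.4.1 (a);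
p. 244 ll. 6–17] — modulo ONE kit law (member admissibility of `Π(ξ)_v`, `hadm`).  Proof: `MatchesS ↔ fSG = fS` (★ `ghOfFibres`), then ★ FILE 3q `trSψ_piXiS_eq`.
[cite: Rogawski1990, §13.2 p. 200 l. 1–3; §13.1 Prop. 13.1.3 (b)(d) p. 199; §12.3 Prop. 12.3.3 p. 178; §14.4 Prop. 14.4.1 (a) p. 235; §14.6 p. 243, p. 244 ll. 6–17] -/
theorem gTraceProductFormW_ghOfFibres_hom
    (ψ : ∀ v : HeightOneSpectrum (𝓞 ↥(maximalRealSubfield L)), (cmDatum L 3 H).Local v ≃ₜ* (cmDatum L 3 (splitForm L 3)).Local v)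
    (νG : ∀ v : HeightOneSpectrum (𝓞 ↥(maximalRealSubfield L)), @Measure ((cmDatum L 3 H).Local v) (borel _))
    (hνl : ∀ v : HeightOneSpectrum (𝓞 ↥(maximalRealSubfield L)), letI : MeasurableSpace ((cmDatum L 3 H).Local v) := borel _; (νG v).IsMulLeftInvariant)
    (hνc : ∀ v : HeightOneSpectrum (𝓞 ↥(maximalRealSubfield L)), letI : MeasurableSpace ((cmDatum L 3 H).Local v) := borel _; IsFiniteMeasureOnCompacts (νG v))
    (μω : HeckeCharacter L) (jInf dsInf : ℤ → ℤ → ℤ → GKIrrClass (uFormGroup (Fin 2) (Fin 1)))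
    (archTr : GKIrrClass (uFormGroup (Fin 2) (Fin 1)) → (UnitaryGroup.arch (↥(maximalRealSubfield L)) L (IsCMField.complexConj L) 3 H → ℂ) → ℂ)
    (hXiS : XiPacketsSignedHom 𝔩 𝔞 μ infOf aTok (transportAPackets ψ Pk') (archPacketOfRecord ι μω jInf dsInf) κ)
    (hadm : ∀ (ξ : OneDimAutRepH L) (v : HeightOneSpectrum (𝓞 ↥(maximalRealSubfield L))), ∀ π ∈ (𝔩 v).mem ((piXiHm hXiS ξ).1.fin.loc v), π.IsAdmissible)
    (wXi : OneDimAutRepH L → ℤ)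
    (hκ : ∀ ξ : OneDimAutRepH L, (κ ξ : ℂ) = (if cptXi₀ ι μω ξ then 1 else 0) * (-1) ^ nCompactOfRecord L * (wXi ξ : ℂ))
    (hg : ∀ f' : TestGp L H, Smooth f' → ∃ (f : TestG L) (fH : TestH L), Matches f' f fH)
    (hsm : ∀ (S : Finset (Places L)) (fS : TestS₀ L H ι T hT S) (fT : Unr₀ L H S), Smooth (tens₀ S fS fT))
    (trHS : ∀ S : Finset (Places L), PH → TestS₀ L H ι T hT S → ℂ)
    (ξd : XiSide L H (HomogPacketG 𝔩 𝔞 μ infOf aTok) PH) (hPi : ∀ ξ : OneDimAutRepH L, ξd.PiXi ξ = piXiHm hXiS ξ)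
    (hPk : ∀ (ξ : OneDimAutRepH L) (v : HeightOneSpectrum (𝓞 ↥(maximalRealSubfield L))), ξd.packFin ξ v = Pk' ξ v) :
    GTraceProductFormW ι T hT
      (ghOfFibres ι T hT (⟨traceGp, Smooth, HomogPacketG 𝔩 𝔞 μ infOf aTok, PH, nG, nH, trG, trH, Matches⟩ : Sockets L H μGp) hg hsm
        (fun S Q fS => Q.1.trSψ ψ S (fun v => @Measure.map _ _ (borel _) _ (ψ v) (νG v)) archTr fS) trHS)
      ξd μω wXi jInf dsInf archTr νG := by
  letI : ∀ v : HeightOneSpectrum (𝓞 ↥(maximalRealSubfield L)), MeasurableSpace ((cmDatum L 3 H).Local v) := fun _ => borel _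
  haveI : ∀ v : HeightOneSpectrum (𝓞 ↥(maximalRealSubfield L)), BorelSpace ((cmDatum L 3 H).Local v) := fun _ => ⟨rfl⟩
  haveI : ∀ v : HeightOneSpectrum (𝓞 ↥(maximalRealSubfield L)), (νG v).IsMulLeftInvariant := hνl
  haveI : ∀ v : HeightOneSpectrum (𝓞 ↥(maximalRealSubfield L)), IsFiniteMeasureOnCompacts (νG v) := hνc
  intro ξ S _ fS fSG fSH hm
  obtain ⟨hfS, -⟩ := hm
  rw [hfS]
  change (ξd.PiXi ξ).1.trSψ ψ S (fun v => @Measure.map _ _ (borel _) _ (ψ v) (νG v)) archTr fS = _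
  rw [hPi ξ, (piXiHm_isSignedPacketOf hXiS ξ).trSψ_eq_mul_finsum (Pk' := Pk' ξ) (hadm ξ) S fS archTr, hκ ξ]
  simp only [hPk ξ, mul_assoc]

end H

/-! ## §3 At the coherent tuple `PG := CohPacketG …` (twin of ★ 3v′ (v5)) -/

section C

variable {L : Type} [Field L] [NumberField L] [IsCMField L] {H : Matrix (Fin 3) (Fin 3) L} {ι : L →+* ℂ} {T : GL (Fin 3) ℂ}
  {hT : (T : Matrix (Fin 3) (Fin 3) ℂ)ᴴ * H.map ι * (T : Matrix (Fin 3) (Fin 3) ℂ) = Literature.Geometry.ComplexHyperbolic.BallModel.J}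
  {𝔩 : ∀ v : HeightOneSpectrum (𝓞 ↥(maximalRealSubfield L)), LocalPacketKit L (splitForm L 3) v} {𝔞 : ArchPacketKit}
  {μ : Measure (adelicGroupData (↥(maximalRealSubfield L)) L (IsCMField.complexConj L) 3 (splitForm L 3)).automorphicQuotient}
  [SMulInvariantMeasure (adelicGroupData (↥(maximalRealSubfield L)) L (IsCMField.complexConj L) 3 (splitForm L 3)).Adelic
    (adelicGroupData (↥(maximalRealSubfield L)) L (IsCMField.complexConj L) 3 (splitForm L 3)).automorphicQuotient μ]
  [∀ v : HeightOneSpectrum (𝓞 ↥(maximalRealSubfield L)), MeasurableSpace ((cmDatum L 3 (splitForm L 3)).Local v)]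
  [∀ v : HeightOneSpectrum (𝓞 ↥(maximalRealSubfield L)), BorelSpace ((cmDatum L 3 (splitForm L 3)).Local v)]
  -- the `G′`-side sockets other than `PacketG` (the letter's `𝔰 := ⟨𝔨.traceGp, 𝔨.Smooth, PG, PH, nG, nH, trG, trH, 𝔨.Matches⟩`)
  {μGp : Measure (Gp L H).automorphicQuotient} [(Gp L H).IsAutomorphicMeasure μGp]
  {infOf : GlobalPacket 𝔩 → 𝔞.PktInf}
  {traceGp : TestGp L H →ₗ[ℂ] ℂ} {Smooth : TestGp L H → Prop} {PH : Type} {nG : CohPacketG 𝔩 𝔞 μ infOf → ℂ} {nH : PH → ℂ}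
  {trG : CohPacketG 𝔩 𝔞 μ infOf → TestG L → ℂ} {trH : PH → TestH L → ℂ} {Matches : TestGp L H → TestG L → TestH L → Prop}
  {Pk' : OneDimAutRepH L → ∀ v : HeightOneSpectrum (𝓞 ↥(maximalRealSubfield L)), CMLocalAPacket L H v} {κ : OneDimAutRepH L → ℤ}

open scoped Classical in
/-- **[ED. 38 «PK-ε» W-TWIN] (v5) (P3′)-G OF LETTER K9-STF AT THE COHERENT TUPLE, BY NAME** (★ 3q′ re-cut at `PG := CohPacketG …`, slots through `.1`).  For the letter's `gh := ghOfFibres ι T hT 𝔰 hg hsm trGS trHS` with the (N) slot `trGS S Q f′_S := Q.trSψ ψ S (ψ_* νG) archTr f′_S`,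
a ξ-side `ξd` reading `PiXi := piXiS hXiS` and `packFin := Pk′`, archimedean A-packets `archPacketOfRecord ι μω jInf dsInf`, and the ξ-DEPENDENT signed scalar `κ ξ = (−1)^N · [cptXi₀ ι μω ξ] · w_ξ` (`w_ξ = ε(½, φ_ξ) ∈ {±1}`, [Rogawski1992 Thm. 1.2]):
`GTraceProductFormW ι T hT gh ξd μω wXi jInf dsInf archTr νG` — «`Tr Π(ξ)_S(f_{S,G}) = [cptXi₀ ξ] · (−1)^N · (A πⁿ_ι − A πˢ_ι) · ∏_{v ∈ S} (Tr πⁿ_v − Tr πˢ_v)(f′_v)`» [13.1.3 (b); 12.3.3 (b); Prop. 14.4.1 (a);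
p. 244 ll. 6–17] — modulo ONE kit law (member admissibility of `Π(ξ)_v`, `hadm`).  Proof: `MatchesS ↔ fSG = fS` (★ `ghOfFibres`), then ★ FILE 3q `trSψ_piXiS_eq`.
[cite: Rogawski1990, §13.2 p. 200 l. 1–3; §13.1 Prop. 13.1.3 (b)(d) p. 199; §12.3 Prop. 12.3.3 p. 178; §14.4 Prop. 14.4.1 (a) p. 235; §14.6 p. 243, p. 244 ll. 6–17] -/
theorem gTraceProductFormW_ghOfFibres_coh
    (ψ : ∀ v : HeightOneSpectrum (𝓞 ↥(maximalRealSubfield L)), (cmDatum L 3 H).Local v ≃ₜ* (cmDatum L 3 (splitForm L 3)).Local v)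
    (νG : ∀ v : HeightOneSpectrum (𝓞 ↥(maximalRealSubfield L)), @Measure ((cmDatum L 3 H).Local v) (borel _))
    (hνl : ∀ v : HeightOneSpectrum (𝓞 ↥(maximalRealSubfield L)), letI : MeasurableSpace ((cmDatum L 3 H).Local v) := borel _; (νG v).IsMulLeftInvariant)
    (hνc : ∀ v : HeightOneSpectrum (𝓞 ↥(maximalRealSubfield L)), letI : MeasurableSpace ((cmDatum L 3 H).Local v) := borel _; IsFiniteMeasureOnCompacts (νG v))
    (μω : HeckeCharacter L) (jInf dsInf : ℤ → ℤ → ℤ → GKIrrClass (uFormGroup (Fin 2) (Fin 1)))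
    (archTr : GKIrrClass (uFormGroup (Fin 2) (Fin 1)) → (UnitaryGroup.arch (↥(maximalRealSubfield L)) L (IsCMField.complexConj L) 3 H → ℂ) → ℂ)
    (hXiS : XiPacketsSignedCoh 𝔩 𝔞 μ infOf (transportAPackets ψ Pk') (archPacketOfRecord ι μω jInf dsInf) κ)
    (hadm : ∀ (ξ : OneDimAutRepH L) (v : HeightOneSpectrum (𝓞 ↥(maximalRealSubfield L))), ∀ π ∈ (𝔩 v).mem ((piXiC hXiS ξ).1.fin.loc v), π.IsAdmissible)
    (wXi : OneDimAutRepH L → ℤ)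
    (hκ : ∀ ξ : OneDimAutRepH L, (κ ξ : ℂ) = (if cptXi₀ ι μω ξ then 1 else 0) * (-1) ^ nCompactOfRecord L * (wXi ξ : ℂ))
    (hg : ∀ f' : TestGp L H, Smooth f' → ∃ (f : TestG L) (fH : TestH L), Matches f' f fH)
    (hsm : ∀ (S : Finset (Places L)) (fS : TestS₀ L H ι T hT S) (fT : Unr₀ L H S), Smooth (tens₀ S fS fT))
    (trHS : ∀ S : Finset (Places L), PH → TestS₀ L H ι T hT S → ℂ)
    (ξd : XiSide L H (CohPacketG 𝔩 𝔞 μ infOf) PH) (hPi : ∀ ξ : OneDimAutRepH L, ξd.PiXi ξ = piXiC hXiS ξ)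
    (hPk : ∀ (ξ : OneDimAutRepH L) (v : HeightOneSpectrum (𝓞 ↥(maximalRealSubfield L))), ξd.packFin ξ v = Pk' ξ v) :
    GTraceProductFormW ι T hT
      (ghOfFibres ι T hT (⟨traceGp, Smooth, CohPacketG 𝔩 𝔞 μ infOf, PH, nG, nH, trG, trH, Matches⟩ : Sockets L H μGp) hg hsm
        (fun S Q fS => Q.1.trSψ ψ S (fun v => @Measure.map _ _ (borel _) _ (ψ v) (νG v)) archTr fS) trHS)
      ξd μω wXi jInf dsInf archTr νG := by
  letI : ∀ v : HeightOneSpectrum (𝓞 ↥(maximalRealSubfield L)), MeasurableSpace ((cmDatum L 3 H).Local v) := fun _ => borel _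
  haveI : ∀ v : HeightOneSpectrum (𝓞 ↥(maximalRealSubfield L)), BorelSpace ((cmDatum L 3 H).Local v) := fun _ => ⟨rfl⟩
  haveI : ∀ v : HeightOneSpectrum (𝓞 ↥(maximalRealSubfield L)), (νG v).IsMulLeftInvariant := hνl
  haveI : ∀ v : HeightOneSpectrum (𝓞 ↥(maximalRealSubfield L)), IsFiniteMeasureOnCompacts (νG v) := hνc
  intro ξ S _ fS fSG fSH hm
  obtain ⟨hfS, -⟩ := hm
  rw [hfS]
  change (ξd.PiXi ξ).1.trSψ ψ S (fun v => @Measure.map _ _ (borel _) _ (ψ v) (νG v)) archTr fS = _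
  rw [hPi ξ, (piXiC_isSignedPacketOf hXiS ξ).trSψ_eq_mul_finsum (Pk' := Pk' ξ) (hadm ξ) S fS archTr, hκ ξ]
  simp only [hPk ξ, mul_assoc]

end C

end Summit.HodgeConjecture.HodgeConjecture.Cruxes.H413.F0P3SpectralPacket.SpectralPacketG

end
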